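import Literature.Computability.Complexity.PolynomialEntropyApproximationDegOne
import Literature.Computability.Complexity.PromiseProofs

/-!
# PneNP / SzkEntropy — crux `PeaThreeNotInP` (stmt-PneNP-10776), negative side: the gap constant is not load-bearing

Route `PneNP/SzkEntropy`, crux X = `PeaThreeNotInP` (`PEA 3 ∉ PromiseP`).  The route fixes the ONE-BIT
gap convention at integer thresholds (yes `H ≥ k + 1`, no `H ≤ k`); print [DGRV, §3 p. 6] allows
any additive constant and remarks that the conventions are inter-reducible by direct powers
`p ↦ pᵗ`, `H(pᵗ) = t · H(p)`.  LOAD-BEARING ANALYSIS of that convention (no Theses decl asserted):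
for every degree `d` and every `t ≥ 1`,

* `PEA_polyTimeReducible_PEAgap` — `PEA d ≤ₚ PEA^{(gap t)} d` (yes `H ≥ k + t`) by the power
  map `(n, p, k) ↦ (n·t, p^{×t}, t·k)`, with a typed `CodeFP` certificate (`codeFP_powMap`);
* `PEAgap_polyTimeReducible_PEA` — `PEA^{(gap t)} d ≤ₚ PEA d` by the identity;
* `PEAfrac_polyTimeReducible_PEA` / `PEA_polyTimeReducible_PEAfrac` — the same for the SMALLER
  gaps `1/t` (yes `H ≥ k + 1/t`), again by `p ↦ p^{×t}` resp. the identity;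
* hence **`PEAgap_mem_PromiseP_iff`, `PEAfrac_mem_PromiseP_iff`**: for all `t ≥ 1`,
  `PEA^{(gap t)} d ∈ PromiseP ↔ PEA d ∈ PromiseP ↔ PEA^{(gap 1/t)} d ∈ PromiseP`.

So thesis X does not depend on the gap constant in either direction: a refutation may assume an
arbitrarily LARGE constant gap, a proof may assume an arbitrarily SMALL one.  (`npow`, the `t`-fold
direct power on `F₂^{n·t}`, and its untyped presentation `npowU` are the only definitions.)

References: Z. Dvir, D. Gutfreund, G. N. Rothblum, S. Vadhan, *On approximating the entropy of
polynomial mappings*, ICS 2011 (ECCC TR10-160), §3 p. 6 ("`H(pᵗ) = t · H(p)`", gap conventions);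
O. Goldreich, *On promise problems* (2006), Def. 1.2, Def. 1.4, §1.2 p. 259; S. Arora, B. Barak,
*Computational Complexity*, CUP 2009, §1.3.
-/

namespace Summit.PneNP.PneNP.Theorems.PeaThreeNotInP.Negative

set_option linter.dupNamespace false -- `Summit.PneNP.PneNP.…`: summit = sub-problem name (D-0017 single-conjunct layout)

open Literature.Computability.Complexity _root_.Computability CodeFP PolyMapF2

variable {n : ℕ}

/-! ### Direct powers -/

/-- The `t`-fold direct power `P^{×t}` of a sparse map, on `t` disjoint blocks of `n` variables
(`F₂^{n·t}`): `P^{×0} = ()`, `P^{×(t+1)} = P^{×t} × P`. [DvirGutfreundRothblumVadhan2010, §3 p. 6] -/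
def npow (P : PolyMapF2 n) : (t : ℕ) → PolyMapF2 (n * t)
  | 0 => []
  | t + 1 => (npow P t).prod P

/-- The untyped presentation of the direct power: block `j` is the untyped map with every variable
index shifted by `n · j`. -/
def npowU (Pu : List (List (List ℕ))) (n : ℕ) : ℕ → List (List (List ℕ))
  | 0 => []
  | t + 1 => npowU Pu n t ++ Pu.map (List.map (List.map fun i => n * t + i))

/-- `H(P^{×t}) = t · H(P)`. [DvirGutfreundRothblumVadhan2010, §3 p. 6] -/
theorem entropy_npow (P : PolyMapF2 n) : ∀ t : ℕ, (npow P t).entropy = t * P.entropy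
  | 0 => by rw [npow, entropy_nil, Nat.cast_zero, zero_mul]
  | t + 1 => by rw [npow, entropy_prod, entropy_npow P t]; push_cast; ring

/-- Direct powers keep the degree bound. [DvirGutfreundRothblumVadhan2010, §3 p. 6] -/
theorem degLE_npow {d : ℕ} {P : PolyMapF2 n} (h : P.DegLE d) : ∀ t : ℕ, (npow P t).DegLE d
  | 0 => degLE_nil d
  | t + 1 => (degLE_npow h t).prod h

/-- Forgetting the `Fin` typing turns `npow` into `npowU`. -/
theorem untyped_npow (P : PolyMapF2 n) : ∀ t : ℕ,
    (npow P t).map (List.map (List.map Fin.val)) = npowU (P.map (List.map (List.map Fin.val))) n t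
  | 0 => rfl
  | t + 1 => by
    rw [npow, npowU, ← untyped_npow P t, PolyMapF2.prod, List.map_append]
    congr 1
    · simp [List.map_map, Function.comp_def]
    · simp [List.map_map, Function.comp_def]

/-! ### The power map on instance codes -/

/-- Shifting every variable index of an untyped map by a computed offset, on codes. [AroraBarak2009, §1.3] -/
theorem codeFP_shift :
    CodeFP (pairE natE (rawE (rawE (rawE natE)))) (rawE (rawE (rawE natE)))
      (fun q => q.2.map (List.map (List.map fun i => q.1 + i))) :=
  (map (map (map natAdd))).congr fun _ => rfl

/-- The untyped power `(n, Pu) ↦ npowU Pu n t` on codes, for each fixed `t` (induction on `t`: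
append one shifted block). [AroraBarak2009, §1.3] -/
theorem codeFP_npowU (t : ℕ) :
    CodeFP (pairE natE (rawE (rawE (rawE natE)))) (rawE (rawE (rawE natE)))
      (fun q => npowU q.2 q.1 t) := by
  induction t with
  | zero => exact (const _ ([] : List (List (List ℕ)))).congr fun _ => rfl
  | succ t ih =>
    have hoff : CodeFP (pairE natE (rawE (rawE (rawE natE)))) natE (fun q => q.1 * t) :=
      natMul.comp ((fst _ _).pair (const _ t))
    have hblock : CodeFP (pairE natE (rawE (rawE (rawE natE)))) (rawE (rawE (rawE natE)))
        (fun q => q.2.map (List.map (List.map fun i => q.1 * t + i))) :=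
      codeFP_shift.comp (hoff.pair (snd _ _))
    exact ((rawAppend _).comp (ih.pair hblock)).congr fun q => by rw [npowU]

/-- **The power map `(n, P, k) ↦ (n·t, P^{×t}, t·k)` on instance codes is computed by a
polynomial-time string function**, for each fixed `t`. [DvirGutfreundRothblumVadhan2010, §3 p. 6;
AroraBarak2009, §1.3] -/
theorem codeFP_powMap (t : ℕ) :
    CodeFP PEAInst.untypedCode PEAInst.untypedCode
      (fun s : ℕ × (List (List (List ℕ)) × ℕ) => (s.1 * t, (npowU s.2.1 s.1 t, t * s.2.2))) := by
  unfold PEAInst.untypedCode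
  -- reading the map as raw nested lists
  have h1 : CodeFP (listE (listE (listE natE))) (rawE (listE (listE natE))) id := rawOfList _
  have h2 : CodeFP (rawE (listE (listE natE))) (rawE (rawE (listE natE))) (fun l => l.map id) :=
    map₀ (rawOfList _)
  have h3 : CodeFP (rawE (rawE (listE natE))) (rawE (rawE (rawE natE)))
      (fun l => l.map fun p => p.map id) := map₀ (map₀ (rawOfList _))
  have hP : CodeFP (pairE natE (pairE (listE (listE (listE natE))) natE)) (rawE (rawE (rawE natE)))
      (fun s => s.2.1) := ((h3.comp (h2.comp h1)).comp (snd _ _).fst').congr fun s => by simp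
  -- writing raw nested lists back as headed lists
  have g3 : CodeFP (rawE (rawE (rawE natE))) (rawE (rawE (listE natE))) (fun l => l.map fun p => p.map id) :=
    map₀ (map₀ (listOfRaw _))
  have g2 : CodeFP (rawE (rawE (listE natE))) (rawE (listE (listE natE))) (fun l => l.map id) :=
    map₀ (listOfRaw _)
  have g1 : CodeFP (rawE (listE (listE natE))) (listE (listE (listE natE))) id := listOfRaw _
  have hL : CodeFP (rawE (rawE (rawE natE))) (listE (listE (listE natE))) id :=
    (g1.comp (g2.comp g3)).congr fun l => by simp
  have hn : CodeFP (pairE natE (pairE (listE (listE (listE natE))) natE)) natE (fun s => s.1) := fst _ _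
  have hk : CodeFP (pairE natE (pairE (listE (listE (listE natE))) natE)) natE (fun s => s.2.2) :=
    (snd _ _).snd'
  have hpow : CodeFP (pairE natE (pairE (listE (listE (listE natE))) natE)) (rawE (rawE (rawE natE)))
      (fun s => npowU s.2.1 s.1 t) := (codeFP_npowU t).comp (hn.pair hP)
  exact ((natMul.comp (hn.pair (const _ t))).pair
    ((hL.comp hpow).pair (natMul.comp ((const _ t).pair hk)))).congr fun _ => rfl

/-- The power of an instance: `(n, P, k) ↦ (n·t, P^{×t}, t·k)`, and its code. -/
theorem encode_powInst (t : ℕ) (I : PEAInst) :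
    PEAInst.encoding.encode (⟨I.1 * t, (npow I.2.1 t, t * I.2.2)⟩ : PEAInst) =
      PEAInst.untypedCode ((PEAInst.untyped I).1 * t,
        (npowU (PEAInst.untyped I).2.1 (PEAInst.untyped I).1 t, t * (PEAInst.untyped I).2.2)) := by
  rw [PEAInst.encode_eq_untypedCode]
  congr 1
  obtain ⟨n, P, k⟩ := I
  simp only [PEAInst.untyped, untyped_npow]

/-! ### Reductions between gap conventions -/

/-- **`PEA d ≤ₚ PEA^{(gap t)} d`** for every `t`: the power map sends `H ≥ k + 1` to
`H(P^{×t}) = tH ≥ tk + t` and `H ≤ k` to `tH ≤ tk`. [DvirGutfreundRothblumVadhan2010, §3 p. 6] -/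
theorem PEA_polyTimeReducible_PEAgap (d t : ℕ) :
    (PEA d).PolyTimeReducible
      (PromiseProblem.ofEncoding PEAInst.encoding
        {I | I.2.1.DegLE d ∧ (I.2.2 : ℝ) + t ≤ I.2.1.entropy}
        {I | I.2.1.DegLE d ∧ I.2.1.entropy ≤ (I.2.2 : ℝ)}) := by
  obtain ⟨f, hf, hF⟩ := codeFP_powMap t
  have key : ∀ I : PEAInst, f (PEAInst.encoding.encode I) =
      PEAInst.encoding.encode (⟨I.1 * t, (npow I.2.1 t, t * I.2.2)⟩ : PEAInst) := by
    intro I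
    rw [PEAInst.encode_eq_untypedCode I, hF, encode_powInst]
  refine ⟨f, hf, ?_, ?_⟩
  · rintro w ⟨I, ⟨hdeg, hH⟩, rfl⟩
    rw [key]
    refine ⟨_, ⟨degLE_npow hdeg t, ?_⟩, rfl⟩
    change (((t * I.2.2 : ℕ) : ℝ)) + t ≤ (npow I.2.1 t).entropy
    rw [entropy_npow]
    have ht : (0 : ℝ) ≤ t := Nat.cast_nonneg t
    push_cast
    nlinarith
  · rintro w ⟨I, ⟨hdeg, hH⟩, rfl⟩
    rw [key]
    refine ⟨_, ⟨degLE_npow hdeg t, ?_⟩, rfl⟩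
    change (npow I.2.1 t).entropy ≤ ((t * I.2.2 : ℕ) : ℝ)
    rw [entropy_npow]
    have ht : (0 : ℝ) ≤ t := Nat.cast_nonneg t
    push_cast
    nlinarith

/-- **`PEA^{(gap t)} d ≤ₚ PEA d`** for `t ≥ 1`, by the identity (a larger gap is a sub-promise).
[Goldreich2006, Def. 1.4] -/
theorem PEAgap_polyTimeReducible_PEA (d : ℕ) {t : ℕ} (ht : 1 ≤ t) :
    (PromiseProblem.ofEncoding PEAInst.encoding
        {I | I.2.1.DegLE d ∧ (I.2.2 : ℝ) + t ≤ I.2.1.entropy}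
        {I | I.2.1.DegLE d ∧ I.2.1.entropy ≤ (I.2.2 : ℝ)}).PolyTimeReducible (PEA d) := by
  refine ⟨id, PolyTimeComputable.id _, ?_, ?_⟩
  · rintro w ⟨I, ⟨hdeg, hH⟩, rfl⟩
    refine ⟨I, ⟨hdeg, ?_⟩, rfl⟩
    have : (1 : ℝ) ≤ t := by exact_mod_cast ht
    linarith
  · rintro w ⟨I, hI, rfl⟩
    exact ⟨I, hI, rfl⟩

/-- **`PEA^{(gap 1/t)} d ≤ₚ PEA d`** for `t ≥ 1`: the power map sends `H ≥ k + 1/t` to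
`tH ≥ tk + 1` and `H ≤ k` to `tH ≤ tk`. [DvirGutfreundRothblumVadhan2010, §3 p. 6] -/
theorem PEAfrac_polyTimeReducible_PEA (d : ℕ) {t : ℕ} (ht : 1 ≤ t) :
    (PromiseProblem.ofEncoding PEAInst.encoding
        {I | I.2.1.DegLE d ∧ (I.2.2 : ℝ) + 1 / t ≤ I.2.1.entropy}
        {I | I.2.1.DegLE d ∧ I.2.1.entropy ≤ (I.2.2 : ℝ)}).PolyTimeReducible (PEA d) := by
  obtain ⟨f, hf, hF⟩ := codeFP_powMap t
  have key : ∀ I : PEAInst, f (PEAInst.encoding.encode I) =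
      PEAInst.encoding.encode (⟨I.1 * t, (npow I.2.1 t, t * I.2.2)⟩ : PEAInst) := by
    intro I
    rw [PEAInst.encode_eq_untypedCode I, hF, encode_powInst]
  have htpos : (0 : ℝ) < t := by exact_mod_cast ht
  refine ⟨f, hf, ?_, ?_⟩
  · rintro w ⟨I, ⟨hdeg, hH⟩, rfl⟩
    rw [key]
    refine ⟨_, ⟨degLE_npow hdeg t, ?_⟩, rfl⟩
    change (((t * I.2.2 : ℕ) : ℝ)) + 1 ≤ (npow I.2.1 t).entropy
    rw [entropy_npow]
    have h1 : (t : ℝ) * ((I.2.2 : ℝ) + 1 / t) ≤ t * I.2.1.entropy :=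
      mul_le_mul_of_nonneg_left hH htpos.le
    rw [mul_add, mul_one_div_cancel htpos.ne'] at h1
    push_cast
    linarith
  · rintro w ⟨I, ⟨hdeg, hH⟩, rfl⟩
    rw [key]
    refine ⟨_, ⟨degLE_npow hdeg t, ?_⟩, rfl⟩
    change (npow I.2.1 t).entropy ≤ ((t * I.2.2 : ℕ) : ℝ)
    rw [entropy_npow]
    push_cast
    nlinarith

/-- **`PEA d ≤ₚ PEA^{(gap 1/t)} d`** for `t ≥ 1`, by the identity. [Goldreich2006, Def. 1.4] -/
theorem PEA_polyTimeReducible_PEAfrac (d : ℕ) {t : ℕ} (ht : 1 ≤ t) :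
    (PEA d).PolyTimeReducible
      (PromiseProblem.ofEncoding PEAInst.encoding
        {I | I.2.1.DegLE d ∧ (I.2.2 : ℝ) + 1 / t ≤ I.2.1.entropy}
        {I | I.2.1.DegLE d ∧ I.2.1.entropy ≤ (I.2.2 : ℝ)}) := by
  refine ⟨id, PolyTimeComputable.id _, ?_, ?_⟩
  · rintro w ⟨I, ⟨hdeg, hH⟩, rfl⟩
    refine ⟨I, ⟨hdeg, ?_⟩, rfl⟩
    have h1 : (1 : ℝ) / t ≤ 1 := by
      rw [div_le_one (by exact_mod_cast ht)]
      exact_mod_cast ht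
    linarith
  · rintro w ⟨I, hI, rfl⟩
    exact ⟨I, hI, rfl⟩

/-! ### The gap constant is not load-bearing for membership in promise-`P` -/

/-- **For every `t ≥ 1`: `PEA^{(gap t)} d ∈ PromiseP ↔ PEA d ∈ PromiseP`.**  Thesis X may thus be
read with an arbitrarily large constant gap. [DvirGutfreundRothblumVadhan2010, §3 p. 6;
Goldreich2006, §1.2 p. 259] -/
theorem PEAgap_mem_PromiseP_iff (d : ℕ) {t : ℕ} (ht : 1 ≤ t) :
    PromiseProblem.ofEncoding PEAInst.encoding
        {I | I.2.1.DegLE d ∧ (I.2.2 : ℝ) + t ≤ I.2.1.entropy}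
        {I | I.2.1.DegLE d ∧ I.2.1.entropy ≤ (I.2.2 : ℝ)} ∈ PromiseP ↔
      PEA d ∈ PromiseP :=
  ⟨fun h => PromiseProblem.mem_PromiseP_of_polyTimeReducible_holds (PEA_polyTimeReducible_PEAgap d t) h,
    fun h => PromiseProblem.mem_PromiseP_of_polyTimeReducible_holds (PEAgap_polyTimeReducible_PEA d ht) h⟩

/-- **For every `t ≥ 1`: `PEA^{(gap 1/t)} d ∈ PromiseP ↔ PEA d ∈ PromiseP`.**  Thesis X may thus be
read with an arbitrarily small constant gap. [DvirGutfreundRothblumVadhan2010, §3 p. 6;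
Goldreich2006, §1.2 p. 259] -/
theorem PEAfrac_mem_PromiseP_iff (d : ℕ) {t : ℕ} (ht : 1 ≤ t) :
    PromiseProblem.ofEncoding PEAInst.encoding
        {I | I.2.1.DegLE d ∧ (I.2.2 : ℝ) + 1 / t ≤ I.2.1.entropy}
        {I | I.2.1.DegLE d ∧ I.2.1.entropy ≤ (I.2.2 : ℝ)} ∈ PromiseP ↔
      PEA d ∈ PromiseP :=
  ⟨fun h => PromiseProblem.mem_PromiseP_of_polyTimeReducible_holds (PEA_polyTimeReducible_PEAfrac d ht) h,
    fun h => PromiseProblem.mem_PromiseP_of_polyTimeReducible_holds (PEAfrac_polyTimeReducible_PEA d ht) h⟩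

end Summit.PneNP.PneNP.Theorems.PeaThreeNotInP.Negative
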